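import Literature.NumberTheory.EllipticCurves.PeriodIndexKummerPhi
import Literature.NumberTheory.EllipticCurves.KummerUnramified
import HarnessLib

/-!
# A uniformiser's Kummer character is onto on inertia (Clark–Sharif 2010, proof of Lemma 19)

Topic `NumberTheory/EllipticCurves`; theorems only. The field-to-Galois bridge for the "near
pair" hypothesis of `index_sub_eq_sq_of_kummerData` (`PeriodIndexKummerIndexPairs`): for the
level field `k ⊂ K̄` (finite over the number field `K`), a prime `𝔓` of `\bar ℤ_K` whose inertia
group lies in `Gal(K̄/k)`, the prime `w` of `k` below `𝔓`, and `π ∈ kˣ` with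
`ord_w(π) ≢ 0 (mod p)` (`P = pⁿ`; in Clark–Sharif `π` generates the principal prime `w = v_i`,
`ord_w(π) = 1`), the Kummer character `f_π : Gal(K̄/k) → ℤ/P` takes a unit value on the inertia
group `I_𝔓`, hence EVERY value ("the ramification index is `P`": `k_v(π^{1/P})/k_v` is totally
ramified of degree `P`, Lemma 19(a)). The proof is the contrapositive of Lang's unramifiedness
criterion `Literature.NumberTheory.EllipticCurves.dvd_log_valuation_of_inertia_fixes_root`
(`KummerUnramified`, for the Galois pair `K̄/k`): if `f_π` took only non-unit values on `I_𝔓`,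
then `I_𝔓` would fix the `p`-th root `(π^{1/P})^{P/p}` of `π`, forcing `p ∣ ord_w(π)`.

Main results: `exists_mem_inertia_isUnit_unitChar`, `exists_mem_inertia_unitChar_eq` (theorems only).

## References

* P. L. Clark, S. Sharif, *Period, index and potential Ш*, Algebra & Number Theory 4 (2010)
  151–174, §3.4 (C1), Lemma 14, Lemma 19(a) (`ClarkSharif2010`).
* S. Lang, *Fundamentals of Diophantine Geometry* (1983), p. 123 (the unramifiedness criterion).
-/

noncomputable section

open scoped Classical Pointwise
open NumberField IsDedekindDomain Field
open Literature.NumberTheory.GaloisRepresentations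

universe u

namespace Literature.NumberTheory.EllipticCurves

variable {K : Type u} [Field K] [NumberField K] {k : IntermediateField K (AlgebraicClosure K)}
  {P : ℕ} [NeZero P] {ζ : AlgebraicClosure K}

omit [NumberField K] in
/-- Every algebraic integer of `K̄` (integral over `𝓞 K`) is integral over `𝓞 k`, and
conversely: both are the integers of `K̄`. [folklore] -/
theorem isIntegral_ringOfIntegers_iff (x : AlgebraicClosure K) :
    IsIntegral (𝓞 k) x ↔ IsIntegral (𝓞 K) x := by
  constructor
  · intro hx
    have hZ : IsIntegral ℤ x := isIntegral_trans _ hx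
    exact hZ.tower_top
  · intro hx
    have hZ : IsIntegral ℤ x := isIntegral_trans _ hx
    exact hZ.tower_top

/-- **A uniformiser's Kummer character takes a unit value on inertia** (Clark–Sharif 2010,
Lemma 19(a): `k_v(π^{1/P})/k_v` is totally ramified). Setting: `k/K` finite, `P = pⁿ`,
`ζ ∈ k` a primitive `P`-th root of unity, `𝔓` a prime of `\bar ℤ_K` with `I_𝔓 ≤ Gal(K̄/k)`,
`w` the prime of `k` below `𝔓` (`hw`), and `π ∈ kˣ` with `p ∤ ord_w(π)`. Then
`f_π(τ) ∈ (ℤ/P)ˣ` for some `τ ∈ I_𝔓`. [cite: ClarkSharif2010, Lemma 19(a) with §3.4 (C1)] -/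
theorem exists_mem_inertia_isUnit_unitChar [NumberField k] {p n : ℕ} (hp : p.Prime)
    (hP : P = p ^ n) (hn : 0 < n) (hζ : IsPrimitiveRoot ζ P) (hζk : ζ ∈ k) (π : (↥k)ˣ)
    {𝔓 : Ideal (absIntegers (𝓞 K) K)} [𝔓.IsPrime]
    (hIN : 𝔓.inertia (absoluteGaloisGroup K) ≤ fixingGal k)
    (w : HeightOneSpectrum (𝓞 k))
    (hw : ∀ x : 𝓞 k, x ∈ w.asIdeal ↔
      ∃ y ∈ 𝔓, ((y : absIntegers (𝓞 K) K) : AlgebraicClosure K) = ((x : k) : AlgebraicClosure K))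
    (hord : ¬(p : ℤ) ∣ WithZero.log (w.valuation k (π : k))) :
    ∃ (τ : absoluteGaloisGroup K) (hτ : τ ∈ 𝔓.inertia (absoluteGaloisGroup K)),
      IsUnit (unitChar P ζ π ⟨τ, hIN hτ⟩) := by
  by_contra hcon
  push Not at hcon
  apply hord
  -- `K̄/k` is Galois
  haveI : IsGalois K (AlgebraicClosure K) := {}
  -- units of `ℤ/pⁿ`
  have hcop : ∀ a : ℕ, a.Coprime P ↔ ¬p ∣ a := fun a ↦ by
    rw [hP, Nat.coprime_pow_right_iff hn, Nat.coprime_comm, hp.coprime_iff_not_dvd]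
  have key : ∀ x : ZMod P, ¬IsUnit x → p ∣ x.val := by
    intro x hx
    by_contra hpx
    apply hx
    rw [show x = ((x.val : ℕ) : ZMod P) from (ZMod.natCast_zmod_val x).symm,
      ZMod.isUnit_iff_coprime]
    exact (hcop _).mpr hpx
  -- the roots
  set α : AlgebraicClosure K := pthRoot P (((π : k) : AlgebraicClosure K)) with hαdef
  have hα : α ^ P = ((π : k) : AlgebraicClosure K) := pthRoot_pow P _
  have hPp : P / p * p = P := by
    rw [hP]
    exact Nat.div_mul_cancel (dvd_pow_self p hn.ne')
  set β : AlgebraicClosure K := α ^ (P / p) with hβdef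
  have hβ : β ^ p = ((π : k) : AlgebraicClosure K) := by
    rw [hβdef, ← pow_mul, hPp, hα]
  -- every `τ ∈ I_𝔓` fixes `β`
  have hfix : ∀ τ (hτ : τ ∈ 𝔓.inertia (absoluteGaloisGroup K)), τ • β = β := by
    intro τ hτ
    have h1 : τ • α = rootPow ζ (unitChar P ζ π ⟨τ, hIN hτ⟩) * α :=
      smul_eq_rootPow_unitChar_mul hζ hζk π ⟨τ, hIN hτ⟩ hα
    obtain ⟨c, hc⟩ := key _ (hcon τ hτ)
    rw [hβdef, smul_pow', h1, mul_pow, rootPow, ← pow_mul, hc, mul_assoc, mul_comm c,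
      ← mul_assoc, mul_comm p, hPp, pow_mul, hζ.pow_eq_one, one_pow, one_mul]
  -- the identity of `K̄` between the two rings of algebraic integers
  let g : integralClosure (𝓞 k) (AlgebraicClosure K) →+* absIntegers (𝓞 K) K :=
    (Subalgebra.val _).toRingHom.codRestrict (absIntegers (𝓞 K) K).toSubring fun x ↦ by
      change (x : AlgebraicClosure K) ∈ integralClosure (𝓞 K) (AlgebraicClosure K)
      rw [mem_integralClosure_iff]
      exact (isIntegral_ringOfIntegers_iff (k := k) _).mp x.2
  have hg : ∀ x, ((g x : absIntegers (𝓞 K) K) : AlgebraicClosure K) = x := fun x ↦ rfl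
  have hgsurj : Function.Surjective g := fun x ↦
    ⟨⟨x, by
      rw [mem_integralClosure_iff]
      exact (isIntegral_ringOfIntegers_iff (k := k) _).mpr x.2⟩, Subtype.ext rfl⟩
  -- the prime of the integral closure of `𝓞 k` and the prime `w` below it
  set 𝔓' : Ideal (integralClosure (𝓞 k) (AlgebraicClosure K)) := 𝔓.comap g with h𝔓'
  haveI : 𝔓'.IsPrime := Ideal.comap_isPrime _ _
  haveI : 𝔓'.LiesOver w.asIdeal := by
    refine ⟨?_⟩
    ext x
    rw [hw, Ideal.under_def, Ideal.mem_comap, h𝔓', Ideal.mem_comap]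
    constructor
    · rintro ⟨y, hy, hyx⟩
      convert hy using 1
      apply Subtype.ext
      rw [hg, hyx]
      exact (IsScalarTower.algebraMap_apply (𝓞 k) k (AlgebraicClosure K) x).symm.trans rfl |>.symm
    · intro h
      refine ⟨_, h, ?_⟩
      rw [hg]
      exact (IsScalarTower.algebraMap_apply (𝓞 k) k (AlgebraicClosure K) x).symm.trans rfl |>.symm
  -- inertia of `𝔓'` in `Gal(K̄/k)` restricts into `I_𝔓`
  have hIner : ∀ σ : AlgebraicClosure K ≃ₐ[k] AlgebraicClosure K,
      σ ∈ 𝔓'.inertia (AlgebraicClosure K ≃ₐ[k] AlgebraicClosure K) → σ β = β := by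
    intro σ hσ
    set τ : absoluteGaloisGroup K := σ.restrictScalars K with hτdef
    have hτI : τ ∈ 𝔓.inertia (absoluteGaloisGroup K) := by
      rw [AddSubgroup.mem_inertia] at hσ ⊢
      intro x
      obtain ⟨y, rfl⟩ := hgsurj x
      have h := hσ y
      change σ • y - y ∈ Ideal.comap g 𝔓 at h
      rw [Ideal.mem_comap, map_sub] at h
      change τ • g y - g y ∈ 𝔓
      have e : τ • g y = g (σ • y) := Subtype.ext rfl
      rwa [e]
    have h := hfix τ hτI
    exact h
  have hp0 : 0 < p := hp.pos
  -- the primitive `p`-th root of unity `ζ^{P/p} ∈ k`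
  have hζp : IsPrimitiveRoot (ζ ^ (P / p)) p := by
    have h := hζ.pow_of_dvd (Nat.div_pos (Nat.le_of_dvd (NeZero.pos P)
      (hP ▸ dvd_pow_self p hn.ne')) hp0).ne' (Nat.div_dvd_of_dvd (hP ▸ dvd_pow_self p hn.ne'))
    rwa [Nat.div_div_self (hP ▸ dvd_pow_self p hn.ne') (NeZero.ne P)] at h
  have hζp' : IsPrimitiveRoot (⟨ζ ^ (P / p), pow_mem hζk _⟩ : k) p :=
    IsPrimitiveRoot.of_map_of_injective (f := algebraMap k (AlgebraicClosure K)) (by exact hζp)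
      (algebraMap k (AlgebraicClosure K)).injective
  have hπ0 : ((π : k)) ≠ 0 := Units.ne_zero π
  exact dvd_log_valuation_of_inertia_fixes_root hp0 hζp' hπ0 (α := β) hβ w 𝔓' hIner

omit [NumberField K] in
/-- `f_a(n^m) = m f_a(n)` (`f_a` is a homomorphism on `𝔤_k`). [folklore] -/
theorem unitChar_pow_right (hζ : IsPrimitiveRoot ζ P) (hζk : ζ ∈ k) (a : (↥k)ˣ) (g : fixingGal k)
    (m : ℕ) : unitChar P ζ a (g ^ m) = m • unitChar P ζ a g := by
  have h1 : unitChar P ζ a 1 = 0 := by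
    have h := unitChar_mul hζ hζk a 1 1
    rw [mul_one] at h
    simpa using h
  induction m with
  | zero => rw [pow_zero, zero_smul, h1]
  | succ m ih => rw [pow_succ, unitChar_mul hζ hζk, ih, succ_nsmul]

/-- **Hence `f_π` is onto on `I_𝔓`**: every `c ∈ ℤ/P` is `f_π(τ)` for some `τ ∈ I_𝔓` (powers
of an element with a unit value). This is the hypothesis "`Θ(a_m, b_m) = ρ(onto, ·)` on the
inertia group" of `index_sub_eq_sq_of_kummerData` for `a_m = π_m`.
[cite: ClarkSharif2010, Lemma 19(a)] -/
theorem exists_mem_inertia_unitChar_eq [NumberField k] {p n : ℕ} (hp : p.Prime)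
    (hP : P = p ^ n) (hn : 0 < n) (hζ : IsPrimitiveRoot ζ P) (hζk : ζ ∈ k) (π : (↥k)ˣ)
    {𝔓 : Ideal (absIntegers (𝓞 K) K)} [𝔓.IsPrime]
    (hIN : 𝔓.inertia (absoluteGaloisGroup K) ≤ fixingGal k)
    (w : HeightOneSpectrum (𝓞 k))
    (hw : ∀ x : 𝓞 k, x ∈ w.asIdeal ↔
      ∃ y ∈ 𝔓, ((y : absIntegers (𝓞 K) K) : AlgebraicClosure K) = ((x : k) : AlgebraicClosure K))
    (hord : ¬(p : ℤ) ∣ WithZero.log (w.valuation k (π : k))) (c : ZMod P) :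
    ∃ (τ : absoluteGaloisGroup K) (hτ : τ ∈ 𝔓.inertia (absoluteGaloisGroup K)),
      unitChar P ζ π ⟨τ, hIN hτ⟩ = c := by
  obtain ⟨τ, hτ, hu⟩ := exists_mem_inertia_isUnit_unitChar hp hP hn hζ hζk π hIN w hw hord
  obtain ⟨u, hu'⟩ := hu
  refine ⟨τ ^ (c * (u⁻¹ : (ZMod P)ˣ)).val, Subgroup.pow_mem _ hτ _, ?_⟩
  have e : (⟨τ ^ (c * ((u⁻¹ : (ZMod P)ˣ) : ZMod P)).val, hIN (Subgroup.pow_mem _ hτ _)⟩ : fixingGal k) =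
      (⟨τ, hIN hτ⟩ : fixingGal k) ^ (c * ((u⁻¹ : (ZMod P)ˣ) : ZMod P)).val := rfl
  rw [e, unitChar_pow_right hζ hζk, ← hu', nsmul_eq_mul, ZMod.natCast_zmod_val,
    Units.inv_mul_cancel_right]

end Literature.NumberTheory.EllipticCurves
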